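import Literature.Computability.AlgebraicComplexity.CKSV22UnlayeredABPCut
import Literature.Computability.AlgebraicComplexity.CKSV22ValiantDepthReduction
import Mathlib.Data.Nat.Log
import HarnessLib

/-!
# Chatterjee–Kumar–She–Volk 2022, Theorem 2: a superlinear lower bound for unlayered ABPs

P. Chatterjee, M. Kumar, A. She, B. L. Volk, *Quadratic lower bounds for algebraic branching programs
and formulas*, comput. complex. **31** (2022) 8 (arXiv:1911.11793), §1.2 Theorem 2 and §4
(Lemma 17, Lemma 18, Corollary 19, Corollary 20; TeX lines 118–120 and 585–658 of the arXiv source —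
the held plain text drops every `\log`, all quotations are from the TeX).

**Theorem 2** (TeX L118–120). "Let `𝔽` be a field and `n ∈ ℕ` such that `char(𝔽) ∤ n`. Then any
unlayered algebraic branching program over `𝔽` with edge labels of degree at most `Δ` computing the
polynomial `Σ_{i=1}^n x_iⁿ` is of size at least `Ω(n log n / (log log n + log Δ))`." Its restatement
**Corollary 20** (TeX L649–651): "Let `𝒜` be an ABP over a field `𝔽`, with edge labels of degree at
most `Δ = n^{o(1)}`, computing `Σ_{i=1}^n x_iⁿ`. Then `𝒜` has at least
`Ω(n log n / (log log n + log Δ))` edges." (The printed proof bounds the number of EDGES — its first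
branch "If the number of edges is at least `n log n/(1000(log log n + log Δ))`, then we already have
our lower bound" is an edge count — so we type the edge form, Corollary 20; "size" in Theorem 2 is
the number of vertices by Definition 1, and for unlayered ABPs read as skew circuits the two agree up
to constants only when every vertex carries an edge.)

## What is proved, and the road taken

* `CKSV2022.UnlayeredABPComputes τ m Δ g` — an unlayered ABP (the tree's Kumar 2019 Def. 1 model:
  `τ` topologically numbered vertices, label matrix, start `s` of in-degree `0`, end `t` of out-degree
  `0`) with at most `m` edges and labels of degree `≤ Δ` computes `g = [s,t]`.
* `CKSV2022.chatterjeeKumarSheVolk2022_thm_2` — **Theorem 2 / Corollary 20 with explicit constants**: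
  over a field `F` with `(n : F) ≠ 0`, if `16·Δ·log₂ n ≤ n` and `1 ≤ Δ`, every unlayered ABP with `m`
  edges and labels of degree `≤ Δ` computing `Σ_{i<n} x_iⁿ` satisfies
  `n·log₂ n ≤ 4·m·(log₂ log₂ n + log₂ Δ + 4)` (all logarithms `Nat.log 2`). The printed hypothesis
  `Δ = n^{o(1)}` ("assuming `n` is large enough") is replaced by the explicit, weaker requirement
  `16 Δ log₂ n ≤ n`.
* `CKSV2022.exists_shallow_cut` — the depth reduction (the content of Lemma 18 + Corollary 19) in ONE
  round: for a program on `τ ≤ 2^k` vertices and any `r ≤ k`, cutting (Definition 14, file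
  `CKSV22UnlayeredABPCut`) at the heads of the edge set `E'` of Valiant's Lemma 16 with `r` bit
  classes (`CKSV2022.valiant_depth_reduction`, file `CKSV22ValiantDepthReduction`) produces a program
  on `2τ` vertex slots with formal degree `≤ Δ·(2^{k−r} + 3)` computing `F + Σ_{j<c} AⱼBⱼ + C δ` with
  `Aⱼ(0) = Bⱼ(0) = 0` and `k·c ≤ r·m`.

**Disclosed deviation (a shorter road).** The printed route is: Lemma 17 (Valiant's `E'` restricted
to heads of depth in `[d/9, 8d/9]`, so that "removing `U` … results in a graph of depth at most
`3d/4`"), Lemma 18 (cut along `U`: depth `≤ 9d/10`, by Claim 15 (2) "the depth of `𝒜'` is at most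
`max{depth(𝒜 ∖ {v}), d_v + 1, d − d_v + 1}`"), and Corollary 19 (iterate `7(log log n + log Δ)` times,
with the edge count growing by `(1 + 8/log n)` per round). We observe that after cutting
SIMULTANEOUSLY at all heads `U = heads(E') ∖ {t}` of Valiant's edge set, the cut program admits the
explicit valid labeling `CKSV2022.cutLabel` — `s ↦ 0`, duplicate slots `↦ 1`, an uncut original
vertex `x ↦ g(x) + 2` where `g < 2^{k−r}` is Valiant's relabeling of `E ∖ E'`, a cut vertex
`↦ 2^{k−r} + 2`, `t ↦ 2^{k−r} + 3` (`CKSV2022.cutLabel_lt`: every edge of the cut program goes up,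
because an original edge between two uncut vertices other than `t` cannot lie in `E'`) — so its depth
is `≤ 2^{k−r} + 3` after a single round with `r ≈ log log n + log Δ` removed classes, and neither the
depth window of Lemma 17 nor the iteration of Corollary 19 (nor Claim 15 (2)) is needed; the win–win
of Corollary 20 with the robust bound Theorem 7 (`chatterjeeKumarSheVolk2022_thm_7_general`, file
`Kum19HomogeneousABPGeneral`) is then run as printed ("It thus follows that `𝒜'` has formal degree at
most `n`. By Theorem 7, it has `Ω(n²/Δ)` vertices, thus `τ = Ω(n²/Δ)`, so that the number of edges is
also `Ω(n²/Δ)`" — the last step uses the pruning `CKSV2022.exists_pruned`, `τ ≤ m + 2`). The constants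
obtained (`1/4` against the printed `1/1000`-type thresholds) are better, and the statement is for
every `n` rather than "large enough".

D-0026: no named facts; everything here is a definition with a body or a theorem.

## References
* [ChatterjeeKumarSheVolk2022] P. Chatterjee, M. Kumar, A. She, B. L. Volk, comput. complex. 31
  (2022) 8, doi:10.1007/s00037-022-00223-8, arXiv:1911.11793 — Theorem 2 (§1.2), §4 Lemma 17,
  Lemma 18, Corollary 19, Corollary 20.
* [Valiant1977] L. G. Valiant, Graph-theoretic arguments in low-level complexity, MFCS 1977 — the
  depth-reduction lemma (tree: `CKSV22ValiantDepthReduction`).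
* [Kumar2019] M. Kumar, comput. complex. 28 (2019) 409–435 — the unlayered ABP model (Def. 1).
-/

noncomputable section

open MvPolynomial Matrix Finset

namespace Literature.Computability.AlgebraicComplexity

namespace CKSV2022

open Kumar2019

/-! ### The model: unlayered ABPs with `m` edges and labels of degree `≤ Δ` -/

section Model

variable {R : Type*} [CommRing R] {ι : Type*}

/-- **Unlayered ABP with at most `m` edges and edge labels of degree `≤ Δ` on `τ` vertices computing
`g`** (CKSV §1.1 "Layered vs. Unlayered … ABPs whose underlying graphs are unlayered, which we call
unlayered ABPs" and "Edge labels … an even more general definition … every edge … labeled by an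
arbitrary polynomial of degree at most `Δ`"; the graph model is the tree's rendering of Kumar 2019,
Def. 1: vertices `Fin τ` numbered topologically, label matrix `N` — `N u v` is the label of the edge
`u → v`, `0` = no edge —, start `s` with no incoming and end `t` with no outgoing edges, and
`[s,t] = pathSum N s t`). The number of edges is the number of nonzero entries (`CKSV2022.supp`).
[cite: ChatterjeeKumarSheVolk2022, §1.1 and Definition 1] -/
def UnlayeredABPComputes (τ m Δ : ℕ) (g : MvPolynomial ι R) : Prop :=
  ∃ (s t : Fin τ) (N : Matrix (Fin τ) (Fin τ) (MvPolynomial ι R)),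
    IsTopological N ∧ (∀ u, N u s = 0) ∧ (∀ v, N t v = 0) ∧ (∀ u v, (N u v).totalDegree ≤ Δ) ∧
      (supp N).card ≤ m ∧ pathSum N s t = g

/-- Non-vacuity / comparison: a program of formal degree `≤ d` in the sense of
`Kumar2019.ABPDegFormalDegreeComputes` is an unlayered ABP with at most `k²` edges.
[cite: ChatterjeeKumarSheVolk2022, §1.1 and Definition 1] -/
theorem _root_.Literature.Computability.AlgebraicComplexity.Kumar2019.ABPDegFormalDegreeComputes.unlayeredABPComputes
    {k Δ d : ℕ} {g : MvPolynomial ι R} (h : ABPDegFormalDegreeComputes k Δ d g) :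
    UnlayeredABPComputes k (k * k) Δ g := by
  obtain ⟨s, t, N, φ, htop, hs, ht, hdeg, -, -, -, hcomp⟩ := h
  refine ⟨s, t, N, htop, hs, ht, hdeg, (Finset.card_le_univ _).trans ?_, hcomp⟩
  rw [Fintype.card_prod, Fintype.card_fin]

/-- Enlarging the formal-degree bound is harmless. [cite: ChatterjeeKumarSheVolk2022, §2] -/
theorem _root_.Literature.Computability.AlgebraicComplexity.Kumar2019.ABPDegFormalDegreeComputes.mono_deg
    {k Δ d d' : ℕ} {g : MvPolynomial ι R} (hdd : d ≤ d') (h : ABPDegFormalDegreeComputes k Δ d g) :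
    ABPDegFormalDegreeComputes k Δ d' g := by
  obtain ⟨s, t, N, φ, htop, hs, ht, hdeg, hφs, hφt, hφ, hcomp⟩ := h
  exact ⟨s, t, N, φ, htop, hs, ht, hdeg, hφs, hφt.trans hdd, hφ, hcomp⟩

end Model

/-! ### The valid labeling of the simultaneously cut program -/

section Label

variable {τ : ℕ}

/-- **The labeling of the program cut at `U`**: `s ↦ 0`, duplicate slots `↦ 1`, uncut original
vertices `x ↦ g x + 2` (with `g` Valiant's relabeling of `E ∖ E'`), cut vertices `↦ D + 2`,
`t ↦ D + 3`. [cite: ChatterjeeKumarSheVolk2022, Lemma 18 (proof, depth bound)] -/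
def cutLabel (s t : Fin τ) (U : Finset (Fin τ)) (g : Fin τ → ℕ) (D : ℕ) (i : Fin (2 * τ)) : ℕ :=
  if i = oV s then 0
  else if i = oV t then D + 3
  else if (i : ℕ) % 2 = 1 then 1
  else if half i ∈ U then D + 2
  else g (half i) + 2

variable (s t : Fin τ) (U : Finset (Fin τ)) (g : Fin τ → ℕ) (D : ℕ)

/-- [cite: ChatterjeeKumarSheVolk2022, Lemma 18 (proof, depth bound)] -/
theorem cutLabel_oV_s : cutLabel s t U g D (oV s) = 0 := by rw [cutLabel, if_pos rfl]

/-- [cite: ChatterjeeKumarSheVolk2022, Lemma 18 (proof, depth bound)] -/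
theorem cutLabel_zV (u : Fin τ) : cutLabel s t U g D (zV u) = 1 := by
  rw [cutLabel, if_neg (oV_ne_zV s u).symm, if_neg (oV_ne_zV t u).symm, if_pos]
  simp

/-- [cite: ChatterjeeKumarSheVolk2022, Lemma 18 (proof, depth bound)] -/
theorem cutLabel_oV {y : Fin τ} (hys : y ≠ s) :
    cutLabel s t U g D (oV y) = if y = t then D + 3 else if y ∈ U then D + 2 else g y + 2 := by
  rw [cutLabel, if_neg fun h => hys (oV_injective h)]
  by_cases hyt : y = t
  · rw [if_pos (congrArg oV hyt), if_pos hyt]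
  · rw [if_neg fun h => hyt (oV_injective h), if_neg hyt, if_neg (by simp), half_oV]

/-- [cite: ChatterjeeKumarSheVolk2022, Lemma 18 (proof, depth bound)] -/
theorem two_le_cutLabel_oV {y : Fin τ} (hys : y ≠ s) : 2 ≤ cutLabel s t U g D (oV y) := by
  rw [cutLabel_oV s t U g D hys]
  split_ifs <;> omega

/-- All labels are `≤ D + 3` when `g < D`. [cite: ChatterjeeKumarSheVolk2022, Lemma 18 (proof, depth bound)] -/
theorem cutLabel_le (hg : ∀ x, g x < D) (i : Fin (2 * τ)) : cutLabel s t U g D i ≤ D + 3 := by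
  rw [cutLabel]
  split_ifs
  · exact Nat.zero_le _
  · exact le_rfl
  · omega
  · omega
  · have := hg (half i); omega

end Label

section LabelValid

variable {F : Type*} [Field F] {n τ : ℕ}

/-- **The labeling is valid on the cut program**: along every possible edge of the program cut at
`U = heads(E') ∖ {t}` the label increases — for an original edge `x → y` between uncut vertices with
`y ≠ t` this is because `(x,y) ∉ E'` (else `y` would be a head of `E'`, i.e. cut), so Valiant's `g`
increases; all other edges run between different tiers of the labeling.
[cite: ChatterjeeKumarSheVolk2022, Lemma 18 (proof, depth bound)] -/
theorem cutLabel_lt {N : Matrix (Fin τ) (Fin τ) (MvPolynomial (Fin n) F)} {s t : Fin τ}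
    (hs : ∀ i, N i s = 0) (ht : ∀ j, N t j = 0) (hst : s ≠ t) {E' : Finset (Fin τ × Fin τ)}
    (hE' : E' ⊆ supp N)
    {g : Fin τ → ℕ} {D : ℕ} (hg : IsValidLabeling (supp N \ E') g) (hgD : ∀ x, g x < D)
    {U : Finset (Fin τ)} (hU : U = (E'.image Prod.snd).erase t) {L : List (Fin τ)}
    (hLU : ∀ u, u ∈ L ↔ u ∈ U) {i j : Fin (2 * τ)} (he : CutEdge N s t L i j) :
    cutLabel s t U g D i < cutLabel s t U g D j := by
  classical
  -- members of `U` are heads of edges, hence `≠ s`, and `≠ t`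
  have hUs : ∀ u, u ∈ U → u ≠ s := by
    intro u hu hus
    rw [hU, Finset.mem_erase, Finset.mem_image] at hu
    obtain ⟨e, he, heu⟩ := hu.2
    have := mem_supp.1 (hE' he)
    rw [heu, hus, hs] at this
    exact this rfl
  have hUt : ∀ u, u ∈ U → u ≠ t := fun u hu => by rw [hU] at hu; exact (Finset.mem_erase.1 hu).1
  rcases he with ⟨x, y, hi, hj, hNxy, hxL⟩ | ⟨u, huL, hi, hj⟩ | ⟨u, -, y, hi, hj, hNuy⟩ | ⟨u, -, hi, hj⟩
  · -- an original edge out of an uncut vertex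
    have hys : y ≠ s := fun h => by rw [h, hs] at hNxy; exact hNxy rfl
    have hxt : x ≠ t := fun h => by rw [h, ht] at hNxy; exact hNxy rfl
    have hxU : x ∉ U := fun h => hxL ((hLU x).2 h)
    rw [hi, hj]
    by_cases hxs : x = s
    · rw [hxs, cutLabel_oV_s]
      exact lt_of_lt_of_le Nat.two_pos (two_le_cutLabel_oV s t U g D hys)
    rw [cutLabel_oV s t U g D hxs, if_neg hxt, if_neg hxU, cutLabel_oV s t U g D hys]
    by_cases hyt : y = t
    · rw [if_pos hyt]; have := hgD x; omega
    rw [if_neg hyt]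
    by_cases hyU : y ∈ U
    · rw [if_pos hyU]; have := hgD x; omega
    rw [if_neg hyU]
    -- `(x,y) ∈ E ∖ E'`
    have hxy : (x, y) ∈ supp N \ E' := by
      refine Finset.mem_sdiff.2 ⟨mem_supp.2 hNxy, fun hmem => hyU ?_⟩
      rw [hU, Finset.mem_erase]
      exact ⟨hyt, Finset.mem_image.2 ⟨(x, y), hmem, rfl⟩⟩
    have := hg _ hxy
    simp only at this
    omega
  · -- `u → t` for a cut vertex `u`
    have huU : u ∈ U := (hLU u).1 huL
    rw [hi, hj, cutLabel_oV s t U g D (hUs u huU), if_neg (hUt u huU), if_pos huU,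
      cutLabel_oV s t U g D hst.symm, if_pos rfl]
    omega
  · -- moved out-edge `z_u → y`
    have hys : y ≠ s := fun h => by rw [h, hs] at hNuy; exact hNuy rfl
    rw [hi, hj, cutLabel_zV]
    exact lt_of_lt_of_le (by norm_num) (two_le_cutLabel_oV s t U g D hys)
  · -- `s → z_u`
    rw [hi, hj, cutLabel_oV_s, cutLabel_zV]
    exact Nat.one_pos

end LabelValid

/-! ### One-round depth reduction (Lemma 18 + Corollary 19, one application of Valiant's lemma) -/

section Shallow

variable {F : Type*} [Field F] {n τ : ℕ}

/-- **Depth reduction in one round** (the content of Lemma 18 and Corollary 19): an acyclic program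
on `τ ≤ 2^k` vertices with labels of degree `≤ Δ` computing `[s,t]`, and `r ≤ k`. Cutting at the heads
of Valiant's edge set `E'` (`k·|E'| ≤ r·m`) gives a program on `2τ` vertex slots, of formal degree at
most `Δ·(2^{k−r} + 3)`, computing `[s,t] + Σ_{j<c} AⱼBⱼ + C δ` with `Aⱼ(0) = Bⱼ(0) = 0` and
`k·c ≤ r·m` ("there exists an ABP `𝒜'`, whose depth is at most `n/Δ`, which computes a polynomial of
the form `F − Σ PᵢQᵢ − δ`, such that `Pᵢ, Qᵢ` are all polynomials without a constant term").
[cite: ChatterjeeKumarSheVolk2022, Lemma 18 and Corollary 19] -/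
theorem exists_shallow_cut {N : Matrix (Fin τ) (Fin τ) (MvPolynomial (Fin n) F)}
    (hN : IsTopological N) {s t : Fin τ} (hs : ∀ i, N i s = 0) (ht : ∀ j, N t j = 0) (hst : s ≠ t)
    {Δ : ℕ} (hdeg : ∀ x y, (N x y).totalDegree ≤ Δ) {k r : ℕ} (hτ : τ ≤ 2 ^ k) (hr : r ≤ k) :
    ∃ (c : ℕ) (A B : Fin c → MvPolynomial (Fin n) F) (δ : F),
      k * c ≤ r * (supp N).card ∧ (∀ j, constantCoeff (A j) = 0) ∧ (∀ j, constantCoeff (B j) = 0) ∧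
        ABPDegFormalDegreeComputes (2 * τ) Δ (Δ * (2 ^ (k - r) + 3))
          (pathSum N s t + ∑ j, A j * B j + C δ) := by
  classical
  -- Valiant's lemma for the edge set, labelled by the topological numbering
  have hval : IsValidLabeling (supp N) (fun v : Fin τ => (v : ℕ)) := fun e he =>
    Fin.lt_def.1 (hN _ _ (mem_supp.1 he))
  have hk' : ∀ e ∈ supp N, ((e.2 : Fin τ) : ℕ) < 2 ^ k := fun e _ => lt_of_lt_of_le e.2.isLt hτ
  obtain ⟨E', hE'sub, hcard, g, hg, hgD⟩ :=
    valiant_depth_reduction (supp N) (fun v : Fin τ => (v : ℕ)) hval hk' hr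
  -- the cut vertices: heads of `E'` other than `t`
  obtain ⟨U, hU⟩ : ∃ U : Finset (Fin τ), U = (E'.image Prod.snd).erase t := ⟨_, rfl⟩
  have hLU : ∀ u, u ∈ U.toList ↔ u ∈ U := fun u => Finset.mem_toList
  have hnd : U.toList.Nodup := Finset.nodup_toList U
  have hsU : s ∉ U := by
    intro hsU
    rw [hU, Finset.mem_erase, Finset.mem_image] at hsU
    obtain ⟨e, he, hes⟩ := hsU.2
    have := mem_supp.1 (hE'sub he)
    rw [hes, hs] at this
    exact this rfl
  have htU : t ∉ U := by rw [hU]; exact Finset.notMem_erase t _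
  have hsL : s ∉ U.toList := fun h => hsU ((hLU s).1 h)
  have htL : t ∉ U.toList := fun h => htU ((hLU t).1 h)
  obtain ⟨A, B, δ, hA, hB, hP⟩ := pathSum_cutList hN hs ht hst U.toList hnd hsL htL
  have hI := cutInv_cutList hN hs ht hst U.toList hnd hsL htL
  refine ⟨U.toList.length, A, B, δ, ?_, hA, hB, ?_⟩
  · have h1 : U.toList.length ≤ E'.card := by
      rw [Finset.length_toList, hU]
      exact (Finset.card_erase_le).trans Finset.card_image_le
    exact (Nat.mul_le_mul_left k h1).trans hcard
  · refine ⟨oV s, oV t, cutList N s t U.toList, fun i => Δ * cutLabel s t U g (2 ^ (k - r)) i,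
      hI.top, hI.col_s, hI.row_t, totalDegree_cutList_le hdeg s t U.toList, ?_, ?_, ?_, hP⟩
    · show Δ * cutLabel s t U g (2 ^ (k - r)) (oV s) = 0
      rw [cutLabel_oV_s, mul_zero]
    · show Δ * cutLabel s t U g (2 ^ (k - r)) (oV t) ≤ Δ * (2 ^ (k - r) + 3)
      rw [cutLabel_oV s t U g _ hst.symm, if_pos rfl]
    · intro u v huv
      have hlt := cutLabel_lt hs ht hst hE'sub hg hgD hU hLU (hI.edge u v huv)
      have hd := totalDegree_cutList_le hdeg s t U.toList u v
      calc Δ * cutLabel s t U g (2 ^ (k - r)) u + (cutList N s t U.toList u v).totalDegree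
          ≤ Δ * cutLabel s t U g (2 ^ (k - r)) u + Δ := Nat.add_le_add_left hd _
        _ = Δ * (cutLabel s t U g (2 ^ (k - r)) u + 1) := by ring
        _ ≤ Δ * cutLabel s t U g (2 ^ (k - r)) v := Nat.mul_le_mul_left Δ hlt

end Shallow

/-! ### Theorem 2 / Corollary 20 -/

section Main

variable {F : Type*} [Field F]

/-- The power sum `Σ x_iⁿ` (`n ≥ 1`) has no constant term. [cite: ChatterjeeKumarSheVolk2022, §2] -/
theorem constantCoeff_psum {n d : ℕ} (hd : d ≠ 0) : constantCoeff (psum (Fin n) F d) = 0 := by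
  rw [psum, map_sum]
  exact Finset.sum_eq_zero fun i _ => by rw [map_pow, constantCoeff_X, zero_pow hd]

/-- **Theorem 2 / Corollary 20 (explicit form).** Over a field `F` with `(n : F) ≠ 0`
("`char(𝔽) ∤ n`"), let `1 ≤ Δ` with `16·Δ·log₂ n ≤ n` (the printed `Δ = n^{o(1)}`, "`n` large
enough"). Then every unlayered ABP with `m` edges and edge labels of degree `≤ Δ` computing
`Σ_{i<n} x_iⁿ` has `n·log₂ n ≤ 4·m·(log₂ log₂ n + log₂ Δ + 4)` — i.e.
`m = Ω(n log n/(log log n + log Δ))` ("`𝒜` has at least `Ω(n log n/(log log n + log Δ))` edges").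
Proof: prune to `τ ≤ m + 2` vertices; if `τ > 2^k`, `k = log₂ n + log₂ log₂ n + 2`, then already
`m ≥ n log₂ n − 1`; otherwise one round of cuts with `r = log₂ log₂ n + log₂ Δ + 4` removed bit
classes (`exists_shallow_cut`) leaves formal degree `≤ Δ(2^{k−r} + 3) ≤ n`, and Theorem 7
(`chatterjeeKumarSheVolk2022_thm_7_general`) gives `(n/Δ − 1)·n ≤ 4τ + 2(n/Δ − 1)·c` with `k·c ≤ r·m`,
whence `m ≥ n log₂ n /16` or `4·r·m ≥ k·n`.
[cite: ChatterjeeKumarSheVolk2022, Theorem 2 and Corollary 20] -/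
theorem chatterjeeKumarSheVolk2022_thm_2 {n Δ τ m : ℕ} (hnF : (n : F) ≠ 0) (hΔ : 1 ≤ Δ)
    (hbig : 16 * Δ * Nat.log 2 n ≤ n) (h : UnlayeredABPComputes τ m Δ (psum (Fin n) F n)) :
    n * Nat.log 2 n ≤ 4 * m * (Nat.log 2 (Nat.log 2 n) + Nat.log 2 Δ + 4) := by
  classical
  obtain ⟨L, hL⟩ : ∃ L, L = Nat.log 2 n := ⟨_, rfl⟩
  rw [← hL] at hbig ⊢
  -- trivial when `log₂ n = 0`
  rcases Nat.eq_zero_or_pos L with hL0 | hLpos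
  · rw [hL0, mul_zero]; exact Nat.zero_le _
  have hn0 : n ≠ 0 := by rintro rfl; rw [Nat.cast_zero] at hnF; exact hnF rfl
  -- `2^L ≤ n < 2^(L+1)`, `2^ℓ ≤ L < 2^(ℓ+1)`, `2^dℓ ≤ Δ < 2^(dℓ+1)`
  obtain ⟨ℓ, hℓ⟩ : ∃ ℓ, ℓ = Nat.log 2 L := ⟨_, rfl⟩
  obtain ⟨dℓ, hdℓ⟩ : ∃ dℓ, dℓ = Nat.log 2 Δ := ⟨_, rfl⟩
  rw [← hℓ, ← hdℓ]
  have hn1 : 2 ^ L ≤ n := hL ▸ Nat.pow_log_le_self 2 hn0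
  have hn2 : n < 2 ^ (L + 1) := hL ▸ Nat.lt_pow_succ_log_self Nat.one_lt_two n
  have hL1 : 2 ^ ℓ ≤ L := hℓ ▸ Nat.pow_log_le_self 2 hLpos.ne'
  have hL2 : L < 2 ^ (ℓ + 1) := hℓ ▸ Nat.lt_pow_succ_log_self Nat.one_lt_two L
  have hΔ1 : 2 ^ dℓ ≤ Δ := hdℓ ▸ Nat.pow_log_le_self 2 (by omega)
  have hΔ2 : Δ < 2 ^ (dℓ + 1) := hdℓ ▸ Nat.lt_pow_succ_log_self Nat.one_lt_two Δ
  have htwo : 2 ≤ n := by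
    have : 2 ≤ 2 ^ L := by
      calc 2 = 2 ^ 1 := by norm_num
        _ ≤ 2 ^ L := Nat.pow_le_pow_right Nat.two_pos hLpos
    exact this.trans hn1
  -- the program
  obtain ⟨s, t, N, hN, hs, ht, hdeg, hm, hcomp⟩ := h
  have hst : s ≠ t := by
    intro hst
    have h1 := pathSum_apply_self hN s
    rw [hst] at h1
    rw [hst, h1] at hcomp
    have := congrArg constantCoeff hcomp
    rw [constantCoeff_psum (F := F) (by omega : n ≠ 0), map_one] at this
    exact one_ne_zero this
  -- prune to `τ' ≤ m + 2` vertices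
  obtain ⟨τ', e, s', t', he, hes, het, hτ', hP', hm'⟩ := exists_pruned N hN s t
  have hN' : IsTopological (N.submatrix e e) := isTopological_submatrix hN he
  have hs' : ∀ i, N.submatrix e e i s' = 0 := fun i => by rw [Matrix.submatrix_apply, hes, hs]
  have ht' : ∀ j, N.submatrix e e t' j = 0 := fun j => by rw [Matrix.submatrix_apply, het, ht]
  have hdeg' : ∀ x y, (N.submatrix e e x y).totalDegree ≤ Δ := fun x y => hdeg _ _
  have hst' : s' ≠ t' := fun h0 => hst (by rw [← hes, ← het, h0])
  have hcomp' : pathSum (N.submatrix e e) s' t' = psum (Fin n) F n := hP'.trans hcomp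
  have hτm : τ' ≤ m + 2 := hτ'.trans (by omega)
  have hmm : (supp (N.submatrix e e)).card ≤ m := hm'.trans hm
  -- parameters
  obtain ⟨k, hk⟩ : ∃ k, k = L + ℓ + 2 := ⟨_, rfl⟩
  obtain ⟨r, hr⟩ : ∃ r, r = ℓ + dℓ + 4 := ⟨_, rfl⟩
  have h4Δ : 4 * Δ ≤ n := le_trans (by nlinarith) hbig
  have hdL : dℓ + 2 ≤ L := by
    have h1 : 2 ^ (dℓ + 2) ≤ n := by
      calc 2 ^ (dℓ + 2) = 4 * 2 ^ dℓ := by ring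
        _ ≤ 4 * Δ := Nat.mul_le_mul_left 4 hΔ1
        _ ≤ n := h4Δ
    have h2 : 2 ^ (dℓ + 2) < 2 ^ (L + 1) := lt_of_le_of_lt h1 hn2
    have := (Nat.pow_lt_pow_iff_right Nat.one_lt_two).1 h2
    omega
  have hrk : r ≤ k := by omega
  have hr4 : 4 ≤ r := by omega
  -- target rewritten with `r`
  rw [show ℓ + dℓ + 4 = r from hr.symm]
  have hgoal_of : n * L ≤ 16 * m → n * L ≤ 4 * m * r := fun h16 =>
    h16.trans (by calc 16 * m = 4 * m * 4 := by ring
                 _ ≤ 4 * m * r := Nat.mul_le_mul_left _ hr4)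
  by_cases hA : 2 ^ k < τ'
  · -- Case A: many vertices, hence many edges
    apply hgoal_of
    have h1 : n * L < 2 ^ k := by
      calc n * L < 2 ^ (L + 1) * L := Nat.mul_lt_mul_of_pos_right hn2 hLpos
        _ ≤ 2 ^ (L + 1) * 2 ^ (ℓ + 1) := Nat.mul_le_mul_left _ hL2.le
        _ = 2 ^ k := by rw [← pow_add, hk]; congr 1; omega
    have h2 : n * L < m + 2 := (h1.trans hA).trans_le hτm
    have h3 : 2 ≤ n * L := le_trans (by norm_num) (Nat.mul_le_mul htwo hLpos)
    omega
  · -- Case B: one round of cuts and the robust bound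
    have hτk : τ' ≤ 2 ^ k := not_lt.1 hA
    obtain ⟨c, A, B, δ, hkc, hA0, hB0, hprog⟩ :=
      exists_shallow_cut hN' hs' ht' hst' hdeg' hτk hrk
    rw [hcomp'] at hprog
    -- formal degree `≤ n`
    have hkr : k - r = L - dℓ - 2 := by omega
    have hdf : Δ * (2 ^ (k - r) + 3) ≤ n := by
      rw [hkr, Nat.mul_add]
      have hpow : 2 ^ (dℓ + 1) * 2 ^ (L - dℓ - 2) * 2 = 2 ^ L := by
        rw [← pow_add, ← pow_succ]; congr 1; omega
      have h1 : Δ * 2 ^ (L - dℓ - 2) * 2 < 2 ^ L := by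
        rw [← hpow]
        exact Nat.mul_lt_mul_of_pos_right
          (Nat.mul_lt_mul_of_pos_right hΔ2 (Nat.two_pow_pos _)) Nat.two_pos
      have h2 : 6 * Δ ≤ n := by
        have : 6 * Δ ≤ 16 * Δ * L := by
          calc 6 * Δ ≤ 16 * Δ * 1 := by omega
            _ ≤ 16 * Δ * L := Nat.mul_le_mul_left _ hLpos
        exact this.trans hbig
      omega
    have hprog' := hprog.mono_deg hdf
    have h7 := chatterjeeKumarSheVolk2022_thm_7_general (K := F) htwo hnF hΔ A B hA0 hB0 (C δ)
      (by rw [totalDegree_C]; omega) hprog'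
    -- `q = n/Δ − 1 ≥ 16 L − 1`
    obtain ⟨Q, hQ⟩ : ∃ Q, Q = n / Δ := ⟨_, rfl⟩
    have hQ16 : 16 * L ≤ Q := by
      have h16 : 16 * L * Δ ≤ n := by
        calc 16 * L * Δ = 16 * Δ * L := by ring
          _ ≤ n := hbig
      rw [hQ]
      exact (Nat.le_div_iff_mul_le (by omega)).2 h16
    obtain ⟨q, hq⟩ : ∃ q, q = n / Δ - 1 := ⟨_, rfl⟩
    rw [← hq] at h7
    have hqQ : q = Q - 1 := by rw [hq, hQ]
    have hq15 : 15 * L ≤ q := by omega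
    have hqpos : 0 < q := by omega
    have hkpos : 0 < k := by omega
    -- multiply Theorem 7 by `k` and use `k c ≤ r m`
    have hkc' : k * c ≤ r * m := hkc.trans (Nat.mul_le_mul_left r hmm)
    have h8 : k * (q * n) ≤ 8 * (k * τ') ∨ k * (q * n) ≤ 4 * (q * (r * m)) := by
      have e1 : k * (q * n) ≤ k * (2 * (2 * τ') + 2 * q * c) := Nat.mul_le_mul_left k h7
      have e2 : k * (2 * (2 * τ') + 2 * q * c) = 4 * (k * τ') + 2 * (q * (k * c)) := by ring
      have e3 : q * (k * c) ≤ q * (r * m) := Nat.mul_le_mul_left q hkc'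
      rw [e2] at e1
      omega
    rcases h8 with h8 | h8
    · -- (i) `q n ≤ 8 τ'`
      apply hgoal_of
      have h9 : q * n ≤ 8 * τ' := Nat.le_of_mul_le_mul_left (by linarith) hkpos
      have h10 : 15 * L * n ≤ q * n := Nat.mul_le_mul_right n hq15
      have h3 : 2 ≤ n * L := le_trans (by norm_num) (Nat.mul_le_mul htwo hLpos)
      have h11 : 15 * L * n = 15 * (n * L) := by ring
      linarith
    · -- (ii) `k n ≤ 4 r m`
      have h9 : k * n ≤ 4 * (r * m) := by
        have : q * (k * n) ≤ q * (4 * (r * m)) := by linarith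
        exact Nat.le_of_mul_le_mul_left this hqpos
      have h10 : L * n ≤ k * n := Nat.mul_le_mul_right n (by omega)
      linarith

end Main

end CKSV2022

end Literature.Computability.AlgebraicComplexity

end
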